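import Mathlib
import HarnessLib
import HarnessLib.Audit
import Summits.QuantumFields.Statement

/-!
Route: InfraredLiouville

DORMANT since 2026-09-03T10:53:11Z (reconciler: no traction for 5 d (last activity statement-checked at 2026-08-29T09:43:45Z); parked, not closed — `ledger route dormant route-QuantumFields-InfraredLiouville --off` to reactivate) — unstaffed, not closed; items shared with open routes are served there. `ledger route dormant <id> --off` reactivates.

# Route InfraredLiouville — the lattice mass gap as an infrared Liouville theorem — compactness plus
rigidity of fixed-β scaling limits

It suffices to show X = IRLiouville ∧ IRCompactness ∧ ThinEdgeExclusion ∧ GapToContinuum (card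
compactness-rigidity-ir-liouville,
spine and sole card; Kenig–Merle shape "compactness + rigidity" for the lattice mass gap). The new
object is the INFRARED LIMIT SET of
Wilson's lattice theory at FIXED coupling β, typed in the Statement's own idiom: a `SpeciesScheme`
with constant β_k = β (so a_k → 0 is the
infrared blow-up x ↦ x/a_k of one fixed lattice theory, a_k L_k → ∞ makes the tori large in blown-up
units), polynomially bounded
multiplicative renormalisations |c_s(k)| ≤ K a_k^(−p), exact centring m_s(k) = torus mean, and a
`LabelledSchwingerFamily` S to which ALL
joint rescaled lattice functions converge on off-diagonal tensors (⁰𝒮). IRLiouville (rigidity): for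
compact simple G and β ≥ β₀ every
such limit is the vacuum (all n ≥ 1 functions vanish on ⁰𝒮). IRCompactness: if some connected
two-point function fails super-polynomial
decay (infinite-volume form), a NON-vacuum limit exists. ThinEdgeExclusion: super-polynomial decay
at all β ≥ β₀ upgrades to ONE
exponential rate m(β) > 0, volume-uniform with norm-type prefactors — the lattice leg (L) in exactly
the shape route ModularSelfDualFold
files. GapToContinuum: the imported continuum complement (L) ⇒ Clay data along a WEAK-COUPLING
scheme (β_k → ∞, `sch.HasWeakCouplingLimit`, Statement re-type 2026-08-16), shared with that route
(its copy awaits the identical restatement). The card's repeller lemma K2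
("asymptotic freedom forbids infrared freedom") is filed informal right after open as the first
foreseen child of IRLiouville.
Lean: `IRLiouville ∧ IRCompactness ∧ ThinEdgeExclusion ∧ GapToContinuum`

## Assembly
Pure logic (sorry-free in Sketch.lean, `theorem closes`, axioms
propext/Classical.choice/Quot.sound): fix G with IsCompactSimpleLieGroup G,
put the Borel σ-algebra on G as the Statement does, take r from Nonempty (LatticeRep G); IRLiouville
gives β₀; for β ≥ β₀ and any A, B,
if super-polynomial decay failed, IRCompactness would produce a non-vacuum infrared limit point,
contradicting IRLiouville — so the
hypothesis of ThinEdgeExclusion holds, which yields the clustering hypothesis of GapToContinuum,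
whose conclusion is the body of YangMills.

Rationale: WHY THIS LINE. Mechanism (card compactness-rigidity-ir-liouville): the roadmap of critical
dispersive PDE — minimal blow-up object by compactness, then
a Liouville theorem kills it (KenigMerle2006; for classical energy-critical Yang–Mills
arXiv:1709.08606) — transplanted with the explicit
dictionary "profile decomposition ↦ subsequential fixed-β scaling limits on ⁰𝒮 (the IR mirror of
Buchholz–Verch scaling-limit states,
doi:10.1142/S0129055X9500044X)", "critical element ↦ non-vacuum IR limit point", "Liouville ↦ no
dilation-covariant RP theory is reachable
from simple-G lattice glue", "energy trapping excludes the trivial bubble ↦ the Gaussian fixed point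
is an IR REPELLER in its only marginal
direction (b₀ = 11C₂(G)/48π² > 0; one Bałaban block step, Balaban1987RG1, Balaban1989LargeFieldII)".
The argument never visits the
crossover scale e^(cβ): it lives at scale ∞ (classification of limits) and at g = 0⁺ (the sign of
one RG step), and G-sensitivity enters
exactly where it must — for U(1) the classification is false (free Maxwell line = Coulomb phase,
FrohlichSpencerCMP1982, Guth1980) and
b₀ = 0. Imported areas: concentration-compactness/rigidity (dispersive PDE), scaling algebras
(AQFT), rigorous RG near the Gaussian
point (constructive QFT), spectral-edge / finite-size mixing upgrades (DobrushinShlosman1987,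
MartinelliOlivieri1994). What no prior
route on YangMills does: every open route here estimates or certifies something AT the crossover
(OneCertifiedCube, FluxBootstrap),
continues in β (GronwallGap, XiCompleteMonotonicity), or manufactures a symmetry
(ModularSelfDualFold); this one replaces the estimate by
a classification of infrared limits and isolates the genuinely open content (IRLiouville) from typed
bookkeeping; negatives index empty.

RANKED CRUXES. #2 IRLiouville (crux) — (card K1 ∪ K2, the rigidity half) for every compact simple G
(IsCompactSimpleLieGroup, Borel σ-algebra) and every faithful unitary lattice representation r there
is β₀ such that for every β ≥ β₀, every sequential scheme sch with constant coupling sch.β ≡ β,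
polynomially bounded renormalisations |c_s(k)| ≤ K_s·a_k^(−p_s), exact centring m_s(k) = ⟨s⟩ on the
torus of side 2L_k+1 at β, and every labelled family S on ℝ⁴ such that ALL joint rescaled lattice
functions latticeSchwinger r.ρ sch k n σ f converge to S n σ F on off-diagonal tensors F = ⊗ f_i: S
n σ F = 0 for all n ≥ 1 and all such F — the only infrared scaling limit of Wilson's simple-G
lattice theory at weak coupling is the vacuum (no free-glue limit, no dynamically abelianised
free-photon limit, no interacting dilation-covariant RP limit). [difficulty: open-problem] (why it
might fail: Contains "4D SU(2) has no Coulomb phase" (class (b), open since Wilson 1974) and "no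
CFT₄ is an IR limit of pure glue" (class (c)); nothing axiomatic forbids an SU(2) → U(1)-photon
flow, and a limit may approach the Gaussian point outside every RG chart.) [KenigMerle2006,
arXiv:1709.08606, doi:10.1142/S0129055X9500044X, Balaban1987RG1, doi:10.1016/0550-3213(94)90124-4,
ChatterjeeYMProb2019, Literature.Barriers.QuantumFields.AbelianMasslessPhaseD4]
#3 ThinEdgeExclusion (crux) — (card K3, thin-edge exclusion + finite-size and prefactor upgrade) for
every compact G, every r : LatticeRep G and every β₀: IF for all β ≥ β₀ and all gauge-invariant
local observables A, B the connected torus time-correlation decays super-polynomially in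
infinite-volume form (∀ p ∃ C ∀ n ∃ S₀ ∀ S ≥ S₀: n^p·|latticeConnectedCorr r.ρ β (2S+1) A B n| ≤ C)
THEN there are β₁ and a rate m(β) > 0 (β ≥ β₁) with |latticeConnectedCorr r.ρ β (2S+1) A B n| ≤
C(A,B)·e^(−m(β)n) for all β ≥ β₁, S ≥ S₀(A,B), n ≤ S — IR-triviality forces a genuine gap of the
transfer matrix (no super-polynomially thin spectral edge), volume-uniformly and with β-uniform
prefactors (the shape HasLatticeMassGap needs; equals ModularSelfDualFold.WeakCouplingLatticeGap's
conclusion). [difficulty: L] (why it might fail: A translation-invariant RP model with spectral edge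
ρ((1−ε,1)) ~ e^(−1/ε) (stretched-exponential decay, IR-trivial yet gapless) is not excluded by any
theorem; femto-torus (S ~ ξ(β)) corrections must stay below norm-type prefactors uniformly in β.)
[DobrushinShlosman1987, MartinelliOlivieri1994, OsterwalderSeilerAnnPhys1978, Seiler1982,
GlimmJaffe1987]
#4 IRCompactness (crux) — (card K4, compactness is not free) for every compact G, r : LatticeRep G,
β and observables A, B: if the connected torus time-correlation of (A,B) at β does NOT decay
super-polynomially in the infinite-volume form above, then there exist a scheme sch (constant
coupling β, polynomially bounded c, exact centring) and a labelled family S with ALL joint rescaled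
lattice functions converging to S on off-diagonal tensors AND some S n σ F ≠ 0 (n ≥ 1, F = ⊗ f_i
off-diagonal) — a non-vacuum infrared limit point exists (normalise one species by its two-point
function at the blow-up scale, zero the rest, extract a joint subsequential limit: needs IR
temperedness of all n-point functions under the two-point normalisation). [difficulty: L] (why it
might fail: Only two-point data are compact for free (RP monotonicity); joint convergence of all
n-point functions under the two-point normalisation needs an a-priori "no IR intermittency" bound
that chessboard/multiple-reflection estimates (smeared fields, contact-dominated) do not give.)
[OsterwalderSchrader1975, doi:10.1142/S0129055X9500044X, GlimmJaffe1987, ChatterjeeYMProb2019]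
#5 GapToContinuum (crux) — (imported complement; restated 2026-08-16 for the Statement re-type
p116790, ModularSelfDualFold's copy stmt-QuantumFields-8902 re-shares once restated identically) for
every compact simple G and r : LatticeRep G, IF Wilson's theory clusters exponentially at every β ≥
β₁ with rate m(β) > 0, volume-uniformly with β-uniform prefactors, THEN there are a sequential
WEAK-COUPLING scheme sch (β_k → ∞: sch.HasWeakCouplingLimit, a_k locked to 1/ξ(β_k)) and OS data T
for all gauge-invariant species with sch.HasWeakCouplingLimit ∧ IsYangMillsFor r sch T, T
non-trivial and non-Gaussian in r.curvature, and Δ > 0 with T.HasMassGap Δ ∧ HasLatticeMassGap r sch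
Δ (the UV/continuum half, owned by the Bałaban-RG / renormalised-trajectory cards). [deps:
ThinEdgeExclusion] [difficulty: open-problem] (why it might fail: β_k → ∞ with a_k ≍ 1/ξ(β_k) needs
ξ(β) → ∞ as β → ∞ (Chatterjee Problem 5.1, open) plus asymptotic scaling, O(4) restoration and a
non-Gaussian limit; no 4D construction with non-trivial Wilson loops exists (Chatterjee 2019 §6);
FixedCouplingUltralocality kills any fixed-β shortcut.) [Balaban1987RG1, Balaban1989LargeFieldII,
MagnenRivasseauSeneor1993, ChatterjeeYMProb2019, JaffeWitten2000]
#9 StrongCouplingIRTrivial (support) — calibration where theorems exist: for every compact G and r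
there is β_s > 0 such that for 0 ≤ β < β_s every infrared limit point (same class as IRLiouville)
has vanishing TWO-point functions on off-diagonal tensors — from the proved torus cluster expansion
(osterwalder_seiler_torusClustering_holds, needed uniformly in the displacement) and the proved
ultralocality estimate (FixedCouplingUltralocality_holds) plus Schwartz-tail and ⁰𝒮-flatness
bookkeeping; validates the typed IR-limit class. [difficulty: M] [OsterwalderSeilerAnnPhys1978,
Literature.Barriers.QuantumFields.FixedCouplingUltralocality,
Literature.MathematicalPhysics.QuantumFieldTheory.osterwalder_seiler_torusClustering]

TWO-LAYER PLAN. Foreseen glued split of IRLiouville (k = 3, depth 1), filed by `route edit --split`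
once the chart vocabulary (Definition requests) lands:
IRLiouville ⇐ LimitCompletion → RepellerLemma → NoAbelianOrInteractingLimit → IRLiouville, where
LimitCompletion (rest of card K4) upgrades
any non-vacuum limit point of the typed class to a reflection-positive, translation-invariant,
W(B₄)-invariant family dilation-covariant
along its subsequence (closed conditions + Banach–Steinhaus on ⁰𝒮 slices); RepellerLemma (card K2,
filed INFORMAL right after open,
rank 6) excludes the free non-abelian glue family via one Bałaban block step on a chart at the
Gaussian point (g′² ≥ g²(1 + 2b₀g² log L)
− Cg⁶, irrelevant directions contracted by L⁻²); NoAbelianOrInteractingLimit (card K1 proper)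
excludes the Weyl-even free-photon sector
of rank-G Maxwell fields and any interacting dilation-covariant RP limit. ThinEdgeExclusion ⇐
SpectralEdgeRegularity (edges of local
spectral measures are gapped or polynomially thick) → FiniteSizeBootstrap (boundary influence
o(L^(−3)) ⇒ exponential mixing with flux
boundary data) → ThinEdgeExclusion. A prover may also land IRLiouville → IRCompactness →
ThinEdgeExclusion →
ModularSelfDualFold.WeakCouplingLatticeGap (pure logic) to close that shared lattice item.
GapToContinuum is not split here.

KILL CRITERIA. IRLiouville refuted — a non-vacuum infrared limit of SU(2) or SU(3) Wilson theory at
large β (a Coulomb-like or conformal IR phase) —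
refutes the lattice half of Clay for that G: close `refuted:IRLiouville` and send the witness to the
negatives index (every lattice-gap
route dies with it). ThinEdgeExclusion refuted by an RP translation-invariant finite-range model
with a super-polynomially thin gapless
edge forces a pivot: restate K3 with the extra input the counterexample lacks (gauge/Wilson
specificity or a regular-variation
hypothesis) — close `refuted:ThinEdgeExclusion` only if the witness is a Wilson gauge theory.
IRCompactness refuted (IR intermittency in a
Wilson theory) kills the compactness half: pivot to two-point-only limits (Källén–Lehmann data) or
close. RepellerLemma refuted on the
hierarchical SU(2) model (approach to the Gaussian point from outside every chart) demotes the line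
to "Liouville without the RG input".
WeakCouplingLatticeGap proved elsewhere moots IRLiouville/IRCompactness/ThinEdgeExclusion as a path
(route superseded; IRLiouville keeps
independent interest); GapToContinuum is shared and closes with the continuum routes.

NOT DECOMPOSED YET. The chart at the Gaussian fixed point (EffectiveActionChart: Banach
neighbourhood of pure-glue effective actions, marginal coordinate g,
one gauge-covariant block map) and the large-field part of one complete step — layer-2 under
RepellerLemma once typed; the taxonomy lemma
𝔱^W = 0 (no local singlet is linear in a Cartan photon, so class (b) is the EVEN photon sector); the
W(B₄) → O(4) upgrade inside class
(c); the regular-variation lemma and the gauge-boundary-condition finite-size bootstrap inside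
ThinEdgeExclusion; the β-uniformity of
prefactors (norm-type bounds C = O(‖A‖∞‖B‖∞)); the constants β₀, b₀-remainder C, block size L. None
is an item at open (D-0019).

CHEAPEST FALSIFIER. ThinEdgeExclusion as a principle: a literature/construct check for a
translation-invariant reflection-positive finite-range lattice model
(any spins, no disorder) whose local spectral measure has a super-polynomially thin edge without a
gap (stretched-exponential clustering)
— quasi-periodic or hierarchical couplings are the natural place to look; `lit search --source arxiv
"stretched exponential decay
correlations gapless"` and `--source zbmath "stretched exponential decay of correlations spectral
gap lattice"` (this unit, 2026-08-15)
returned 0 rows, so no catalogued witness yet. Second: RepellerLemma's corollary on Gallavotti-type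
hierarchical SU(2) gauge models where
charts are explicit. Not runnable by kit in this unit (no hierarchical-gauge code in the tree).

NUMBERS. b₀ = 11C₂(G)/(48π²) (one-loop, pure glue; SU(N): 11N/48π²), zero for U(1); strong-coupling
clustering radius β₀(G, ρ, 4) and mass
m ≥ −4 log(Cβ) of OsterwalderSeilerAnnPhys1978 Thm 3.5 (tree fact
osterwalder_seiler_torusClustering, PROVED) — the regime of the
support item; free-photon class (b): two-point function of :f²: ∝ |x|⁻⁸ (normalisation c_s = a⁻⁴,
inside the polynomial class);
U(1)₄ Coulomb threshold (Guth1980, FrohlichSpencerCMP1982; Wilson-action masslessness = open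
conjecture AbelianMasslessPhaseD4). Items at
open: 6 typed (IRLiouville, ThinEdgeExclusion, IRCompactness, GapToContinuum,
StrongCouplingIRTrivial, Assembly) + 1 informal crux
(RepellerLemma, rank 6) = 7; cruxes = 5.

DEFINITION REQUESTS. D1 (`--kind definition`, topic Summits/QuantumFields/YangMills/Theorems, for
RepellerLemma): `EffectiveActionChart G L` — a posited
INTERFACE (structure + axioms, no existence smuggled): a Banach space of gauge-invariant
unit-lattice effective actions for gauge group G
(small-field analytic part + large-field weights, Bałaban CMP 109/122 format), a neighbourhood 𝒰 of
the free (Gaussian) action, a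
marginal coordinate g : 𝒰 → ℝ≥0 with g = 0 exactly on the free action, and ONE gauge-covariant
L-block renormalisation map R defined on
𝒰; its CONSTRUCTION for Wilson's action at large β is a separate statement (child of RepellerLemma).
D2 (optional convenience, same
topic): `IsIRLimitAt r β sch S` naming the typed class (constant β, polynomial c, centred m, joint
convergence on ⁰𝒮) so that later
restatements are short. Cite facts wanted (not filed now): Bałaban's one-step effective-action
theorem with one-loop coupling flow and
remainder (Balaban1987RG1 Thm 1; Balaban1989LargeFieldII) as a named Literature fact usable as `(h :
Fact) →`.

Novelty: Searches (2026-08-15, this unit; local searchd unavailable rc 75 all session, OpenAlex/S2 HTTP 429):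
`lit galaxy search "non-abelian
Coulomb phase" --star all` (1 row: Banks, Modern QFT — textbook prose), `lit galaxy search "infrared
fixed point lattice gauge theory
rigorous" --star all` (0), `"scaling limit of lattice gauge theory" --star all` (0); `lit search
--source zbmath "concentration
compactness Yang-Mills"` (8 rows: Côte–Kenig–Merle doi:10.1007/s00220-008-0604-4 radial 4D YM
scattering, Rivière, Chen–Wentworth — all
classical/geometric); `--source crossref "threshold theorem energy critical Yang-Mills"` (Oh–Tataru
doi:10.4007/annals.2021.194.2.1,
doi:10.1090/bull/1640); `--source arxiv "scaling algebras renormalization group Buchholz Verch"` (6: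
hep-th/9501063, hep-th/9708095,
arXiv:0711.4237, math-ph/0201042 Morsella's intrinsic UV confinement notion, hep-th/9907167);
`--source arxiv "Coulomb phase non-abelian
lattice gauge theory absence"` (1: hep-lat/0401003, numerics); `--source zbmath "Balaban lattice
gauge renormalization"` (10 Bałaban CMP
papers incl. doi:10.1007/bf01215223, bf01257412, bf01238433); `--source crossref "no-go theorem
infrared fixed point pure Yang-Mills …"`
(FRG physics: doi:10.1088/1742-6596/378/1/012042, doi:10.1007/s100529801033); `lit frontier
QuantumFields --since 2020` (30 rows; nearest:
arXiv:2401.10507 SU(2) YM–Higgs scaling limit, arXiv:2606.19362 claimed RP construction — neither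
classifies IR limits); `lit bridges
QuantumFields --cro  [refs: 10.1007/s00220-008-0604-4, 10.4007/annals.2021.194.2.1, 10.1090/bull/1640, 10.1007/bf01215223, 10.1088/1742-6596/378/1/012042, 10.1007/s100529801033, 10.1142/S0129055X9500044X, 0711.4237, 2401.10507, 2606.19362, 1709.08606, math-ph/0201042, doi:10.1007/s00220-008-0604-4, doi:10.4007/annals.2021.194.2.1, doi:10.1090/bull/1640, doi:10.1007/bf01215223, doi:10.1088/1742-6596/378/1/012042, doi:10.1007/]

Barriers (technique_class: compactness-rigidity, ir-liouville, rg-repeller, thin-edge): - technique_class: compactness-rigidity, ir-liouville, rg-repeller, thin-edge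
- Literature.Barriers.QuantumFields.AbelianDeconfinementD4: evaded by construction — IRLiouville
quantifies over compact SIMPLE G and is FALSE for U(1) (the free Maxwell line: a non-vacuum IR limit
with c = a⁻⁴ exists in the Coulomb phase, Guth1980/FrohlichSpencerCMP1982; Wilson form = open
conjecture AbelianMasslessPhaseD4), and the repeller lemma is void there (b₀ = 0); ThinEdgeExclusion
and IRCompactness are stated for all compact G but are implications whose hypotheses fail for U(1);
GroupBlindClusteringD4 / GroupBlindIrrepAreaLawD4 are instantiated by no item.
- Literature.Barriers.QuantumFields.FixedCouplingUltralocality: consistent, and used — the barrier's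
proved estimate says a massive fixed-β theory has only ultralocal/vacuum polynomially-renormalised
scaling limits, which is exactly IRLiouville's conclusion (and the support item's proof); the route
never builds the continuum theory at fixed β: GapToContinuum takes β_k → ∞ with a_k locked to the
lattice mass.
- Literature.Barriers.QuantumFields.PerturbativeInvisibility: respected — perturbation theory enters
only through the SIGN of one RG step at g = 0⁺ (RepellerLemma); the scale e^(−cβ) is never computed,
m(β) is whatever ThinEdgeExclusion outputs.
- Literature.Barriers.QuantumFields.UVStabilityNonUniqueness: RepellerLemma needs one controlled
block step uniformly on a chart, not convergence or uniqueness of an iterated scheme; GapToCont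

History (route lifecycle, newest last):
- 2026-08-16T17:35:34Z · rev 4: restated GapToContinuum (stmt-QuantumFields-8902) — route-repair (statement-revised p116790, unit rrepair-QuantumFields-InfraredLiouvill-04472d9e): def YangMills gained the conjunct sch.HasWeakCouplingLimit. In t (planner-rrepair-QuantumFields-InfraredLiouvill-04472d9e-0)
- 2026-08-23T07:14:04Z · DORMANT — reconciler: no traction for 6 d (last activity statement-grounded at 2026-08-17T07:22:32Z); parked, not closed — `ledger route dormant route-QuantumFields-Infra (operator:999:2138488)
- 2026-08-29T09:42:38Z · REACTIVATED — reconciler: reactivated — activity statement-checked at 2026-08-29T08:51:46Z after parking at 2026-08-23T07:14:04Z (operator:999:3783318)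
- 2026-09-03T10:53:11Z · DORMANT — reconciler: no traction for 5 d (last activity statement-checked at 2026-08-29T09:43:45Z); parked, not closed — `ledger route dormant route-QuantumFields-Infrar (operator:999:907093)

sub-problem: YangMills · status: dormant · opened planner-plancard-QuantumFields-YangMills-comp-aecb499c-0 2026-08-15T14:15:10Z · rev 5 · ledger route-QuantumFields-InfraredLiouville
GENERATED by the gate from the ledger (D-0016/17). Provers cite these decls: `theorem foo : Summit.QuantumFields.YangMills.Theses.InfraredLiouville.<Decl> := …` in Summits/QuantumFields/YangMills/Theorems/<Name>.lean.
-/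

namespace Summit.QuantumFields.YangMills.Theses.InfraredLiouville

open scoped BigOperators Topology Manifold Classical MeasureTheory ProbabilityTheory Matrix InnerProductSpace ComplexConjugate ContinuousMap
open Filter Set Function TopologicalSpace MeasureTheory

attribute [summit_statement] _root_.YangMills

/-- item stmt-QuantumFields-9705 · crux · rank 2 · open · by planner
why it might fail: Contains 'SU(2) Wilson theory has no Coulomb/conformal IR phase at β ≥ β₀' (open since 1974); false for U(1) (free-photon IR limit, c = a⁻⁴: Guth, Fröhlich–Spencer; AbelianMasslessPhaseD4); nothing rigorous forbids SU(2)→U(1) abelianisation; a limit may hit the Gaussian point outside every RG chart.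
sources: KenigMerle2006, arXiv:1709.08606, doi:10.1142/S0129055X9500044X, doi:10.1016/0550-3213(94)90124-4, Guth1980, FrohlichSpencerCMP1982
[crux] (card K1 ∪ K2, the rigidity half) for every compact simple G (IsCompactSimpleLieGroup, Borel
σ-algebra) and every faithful unitary lattice representation r there is β₀ such that for every β ≥
β₀, every sequential scheme sch with constant coupling sch.β ≡ β, polynomially bounded
renormalisations |c_s(k)| ≤ K_s·a_k^(−p_s), exact centring m_s(k) = ⟨s⟩ on the torus of side 2L_k+1
at β, and every labelled family S on ℝ⁴ such that ALL joint rescaled lattice functions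
latticeSchwinger r.ρ sch k n σ f converge to S n σ F on off-diagonal tensors F = ⊗ f_i: S n σ F = 0
for all n ≥ 1 and all such F — the only infrared scaling limit of Wilson's simple-G lattice theory
at weak coupling is the vacuum (no free-glue limit, no dynamically abelianised free-photon limit, no
interacting dilation-covariant RP limit). [difficulty: open-problem] -/
@[route_item "route-QuantumFields-InfraredLiouville"]
def IRLiouville : Prop :=
  open Literature.MathematicalPhysics.QuantumFieldTheory Literature.MathematicalPhysics.QuantumLattice Literature.MathematicalPhysics.AQFT in ∀ (G : Type) [Group G] [TopologicalSpace G] [IsTopologicalGroup G] [CompactSpace G] [MeasurableSpace G] [BorelSpace G], IsCompactSimpleLieGroup G → ∀ r : LatticeRep G, ∃ β₀ : ℝ, ∀ β : ℝ, β₀ ≤ β → ∀ (sch : SpeciesScheme (YMSpecies G)) (S : LabelledSchwingerFamily (YMSpecies G) (EuclideanSpace ℝ (Fin 4))), (∀ k : ℕ, sch.β k = β) → (∀ s : YMSpecies G, ∃ (p : ℕ) (K : ℝ), ∀ k : ℕ, |sch.c s k| ≤ K * (sch.a k)⁻¹ ^ p) → (∀ (s : YMSpecies G) (k : ℕ), sch.m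 s k = ∫ U, s.F (torusLift (sch.side k) U) ∂(wilsonMeasure (d := 4) (L := sch.side k) r.ρ (sch.β k))) → (∀ n : ℕ, n ≠ 0 → ∀ (σ : Fin n → YMSpecies G) (f : Fin n → SchwartzMap (EuclideanSpace ℝ (Fin 4)) ℝ) (F : SchwartzMap (Fin n → EuclideanSpace ℝ (Fin 4)) ℂ), IsTensorOf F (fun i => ofRealTest (f i)) → IsOffDiagonal F → Filter.Tendsto (fun k : ℕ => ((latticeSchwinger r.ρ sch (fun s => s.F) k n σ f : ℝ) : ℂ)) Filter.atTop (nhds (S n σ F))) → ∀ n : ℕ, n ≠ 0 → ∀ (σ : Fin n → YMSpecies G) (f : Fin n → SchwartzMap (EuclideanSpace ℝ (Fin 4)) ℝ) (F : SchwartzMap (Fin n → EuclideanSpace ℝ (Fin 4)) ℂ), IsTensorOf F (fun i => ofRealTest (f i)) → IsOffDiagonal F → S n σ F = 0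

/-- item stmt-QuantumFields-9706 · crux · rank 3 · open · by planner
why it might fail: Super-polynomial ⇒ exponential is false for general RP transfer matrices (edge density e^(−1/(1−λ)): e^(−2√n) clustering, gapless); decay⇒gap upgrades (Simon–Lieb, Dobrushin–Shlosman, Martinelli–Olivieri–Schonmann) need FKG or boundary-uniform mixing, unknown for gauge fields; + inf_S torus gap > 0.
sources: Simon1980CMP, Lieb1980, DobrushinShlosman1987, doi:10.1007/bf02099735, doi:10.1214/aop/1078415842, MartinelliOlivieri1994
[crux] (card K3, thin-edge exclusion + finite-size and prefactor upgrade) for every compact G, every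
r : LatticeRep G and every β₀: IF for all β ≥ β₀ and all gauge-invariant local observables A, B the
connected torus time-correlation decays super-polynomially in infinite-volume form (∀ p ∃ C ∀ n ∃ S₀
∀ S ≥ S₀: n^p·|latticeConnectedCorr r.ρ β (2S+1) A B n| ≤ C) THEN there are β₁ and a rate m(β) > 0
(β ≥ β₁) with |latticeConnectedCorr r.ρ β (2S+1) A B n| ≤ C(A,B)·e^(−m(β)n) for all β ≥ β₁, S ≥
S₀(A,B), n ≤ S — IR-triviality forces a genuine gap of the transfer matrix (no super-polynomially
thin spectral edge), volume-uniformly and with β-uniform prefactors (the shape HasLatticeMassGap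
needs; equals ModularSelfDualFold.WeakCouplingLatticeGap's conclusion). [difficulty: L] -/
@[route_item "route-QuantumFields-InfraredLiouville"]
def ThinEdgeExclusion : Prop :=
  open Literature.MathematicalPhysics.QuantumFieldTheory in ∀ (G : Type) [Group G] [TopologicalSpace G] [IsTopologicalGroup G] [CompactSpace G] [MeasurableSpace G] [BorelSpace G] (r : LatticeRep G) (β₀ : ℝ), (∀ β : ℝ, β₀ ≤ β → ∀ A B : YMSpecies G, ∀ p : ℕ, ∃ C : ℝ, ∀ n : ℕ, ∃ S₀ : ℕ, ∀ S : ℕ, S₀ ≤ S → (n : ℝ) ^ p * |latticeConnectedCorr r.ρ β (2 * S + 1) A.F B.F n| ≤ C) → ∃ (β₁ : ℝ) (m : ℝ → ℝ), (∀ β : ℝ, β₁ ≤ β → 0 < m β) ∧ ∀ A B : YMSpecies G, ∃ (C : ℝ) (S₀ : ℕ), ∀ β : ℝ, β₁ ≤ β → ∀ S : ℕ, S₀ ≤ S → ∀ n : ℕ, n ≤ S → |latticeConnectedCorr r.ρ β (2 * S + 1) A.F B.F n| ≤ C * Real.exp (-(m β * n))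

/-- item stmt-QuantumFields-9707 · crux · rank 4 · open · by planner
why it might fail: RP monotonicity makes only the axis two-point function compact; a non-vacuum limit on ⁰𝒮 needs k-uniform bounds on separated-point moments c_kⁿ⟨Ā(x₁)…Ā(x_n)⟩ (no Gaussian/tree domination for gauge fields) and non-vanishing off the axes (a null set); IR intermittency can force the vacuum.
sources: OsterwalderSchraderCMP1975, doi:10.1142/S0129055X9500044X, GlimmJaffeQP1987, FrohlichSpencerCMP1982, LaanaitMessagerRuiz1989, ChatterjeeYMProb2019
[crux] (card K4, compactness is not free) for every compact G, r : LatticeRep G, β and observables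
A, B: if the connected torus time-correlation of (A,B) at β does NOT decay super-polynomially in the
infinite-volume form above, then there exist a scheme sch (constant coupling β, polynomially bounded
c, exact centring) and a labelled family S with ALL joint rescaled lattice functions converging to S
on off-diagonal tensors AND some S n σ F ≠ 0 (n ≥ 1, F = ⊗ f_i off-diagonal) — a non-vacuum infrared
limit point exists (normalise one species by its two-point function at the blow-up scale, zero the
rest, extract a joint subsequential limit: needs IR temperedness of all n-point functions under the
two-point normalisation). [difficulty: L] -/
@[route_item "route-QuantumFields-InfraredLiouville"]
def IRCompactness : Prop :=
  open Literature.MathematicalPhysics.QuantumFieldTheory Literature.MathematicalPhysics.QuantumLattice Literature.MathematicalPhysics.AQFT in ∀ (G : Type) [Group G] [TopologicalSpace G] [IsTopologicalGroup G] [CompactSpace G] [MeasurableSpace G] [BorelSpace G] (r : LatticeRep G) (β : ℝ) (A B : YMSpecies G), ¬ (∀ p : ℕ, ∃ C : ℝ, ∀ n : ℕ, ∃ S₀ : ℕ, ∀ S : ℕ, S₀ ≤ S → (n : ℝ) ^ p * |latticeConnectedCorr r.ρ β (2 * S + 1) A.F B.F n| ≤ C) → ∃ (sch : SpeciesScheme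 (YMSpecies G)) (S : LabelledSchwingerFamily (YMSpecies G) (EuclideanSpace ℝ (Fin 4))), (∀ k : ℕ, sch.β k = β) ∧ (∀ s : YMSpecies G, ∃ (p : ℕ) (K : ℝ), ∀ k : ℕ, |sch.c s k| ≤ K * (sch.a k)⁻¹ ^ p) ∧ (∀ (s : YMSpecies G) (k : ℕ), sch.m s k = ∫ U, s.F (torusLift (sch.side k) U) ∂(wilsonMeasure (d := 4) (L := sch.side k) r.ρ (sch.β k))) ∧ (∀ n : ℕ, n ≠ 0 → ∀ (σ : Fin n → YMSpecies G) (f : Fin n → SchwartzMap (EuclideanSpace ℝ (Fin 4)) ℝ) (F : SchwartzMap (Fin n → EuclideanSpace ℝ (Fin 4)) ℂ), IsTensorOf F (fun i => ofRealTest (f i)) → IsOffDiagonal F → Filter.Tendsto (fun k : ℕ => ((latticeSchwinger r.ρ sch (fun s => s.F) k n σ f : ℝ) : ℂ)) Filter.atTop (nhds (S n σ F))) ∧ ∃ n : ℕ, n ≠ 0 ∧ ∃ (σ : Fin n → YMSpecies G) (f : Fin n → SchwartzMap (EuclideanSpace ℝ (Fin 4)) ℝ) (F : SchwartzMap (Fin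 n → EuclideanSpace ℝ (Fin 4)) ℂ), IsTensorOf F (fun i => ofRealTest (f i)) ∧ IsOffDiagonal F ∧ S n σ F ≠ 0

-- earlier GapToContinuum (stmt-QuantumFields-8902, replaced 2026-08-16T17:35:34Z -> stmt-QuantumFields-15914): retired by None — ∀ (G : Type) [Group G] [TopologicalSpace G] [IsTopologicalGroup G] [CompactSpace G] [MeasurableSpace G] [BorelSpace G], Literature.MathematicalPhysics.QuantumFieldTheory.IsCompactSimpleLieGroup G → ∀ r : Literature.MathematicalPhysics.QuantumFieldTheory.LatticeRep G, (∃ (β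
/-- item stmt-QuantumFields-15914 · crux · rank 5 · open · by planner
why it might fail: β_k → ∞ with a_k ≍ 1/ξ(β_k) needs ξ(β) → ∞ as β → ∞ (Chatterjee Problem 5.1, open: bounded ξ keeps the hypothesis true while the conclusion fails by ultralocality), plus asymptotic scaling, O(4) restoration and a non-Gaussian limit — the open Bałaban/MRS programme.
sources: Balaban1987RG1, Balaban1989LargeFieldII, MagnenRivasseauSeneor1993, ChatterjeeYMProb2019, JaffeWitten2000, Dimock2013
[crux] (C), the imported continuum complement, pointwise in (G, r) — RESTATED 2026-08-16 for the
Statement re-type p116790 (the ∃-conclusion gains `sch.HasWeakCouplingLimit`): for every compact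
simple G and every r : LatticeRep G, IF Wilson's theory clusters exponentially at every β ≥ β₁ with
rate m(β) > 0, volume-uniformly with β-uniform prefactors (the conclusion of ThinEdgeExclusion, =
ModularSelfDualFold.WeakCouplingLatticeGap), THEN there are a sequential WEAK-COUPLING scheme sch
(a_k → 0, a_k L_k → ∞, β_k = 2/g₀(a_k)² → ∞: the continuum limit is taken at the asymptotically free
Gaussian ultraviolet point with a_k locked to the lattice mass, a_k ≍ 1/ξ(β_k) — never at fixed or
bounded β, which FixedCouplingUltralocality kills anyway) and OS data T for all gauge-invariant
species with sch.HasWeakCouplingLimit ∧ IsYangMillsFor r sch T, T non-trivial and non-Gaussian in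
r.curvature, and Δ > 0 with T.HasMassGap Δ ∧ HasLatticeMassGap r sch Δ — the UV/continuum half
(uniform lattice massiveness in, Clay data out), owned by the Bałaban-RG / renormalised-trajectory
cards and attachable by their routes; ModularSelfDualFold's copy (stmt-QuantumFields-8902) needs the
identical restatement -/
@[route_item "route-QuantumFields-InfraredLiouville"]
def GapToContinuum : Prop :=
  ∀ (G : Type) [Group G] [TopologicalSpace G] [IsTopologicalGroup G] [CompactSpace G] [MeasurableSpace G] [BorelSpace G], Literature.MathematicalPhysics.QuantumFieldTheory.IsCompactSimpleLieGroup G → ∀ r : Literature.MathematicalPhysics.QuantumFieldTheory.LatticeRep G, (∃ (β₁ : ℝ) (m : ℝ → ℝ), (∀ β : ℝ, β₁ ≤ β → 0 < m β) ∧ ∀ A B : Literature.MathematicalPhysics.QuantumFieldTheory.YMSpecies G, ∃ (C : ℝ) (S₀ : ℕ), ∀ β : ℝ, β₁ ≤ β → ∀ S : ℕ, S₀ ≤ S → ∀ n : ℕ, n ≤ S → |Literature.MathematicalPhysics.QuantumFieldTheory.latticeConnectedCorr r.ρ β (2 * S + 1) A.F B.F n| ≤ C * Real.exp (-(m β * n)))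 → ∃ (sch : Literature.MathematicalPhysics.QuantumFieldTheory.SpeciesScheme (Literature.MathematicalPhysics.QuantumFieldTheory.YMSpecies G)) (T : Literature.MathematicalPhysics.QuantumFieldTheory.OSData (Literature.MathematicalPhysics.QuantumFieldTheory.YMSpecies G) 4), sch.HasWeakCouplingLimit ∧ Literature.MathematicalPhysics.QuantumFieldTheory.IsYangMillsFor r sch T ∧ T.IsNontrivial r.curvature ∧ T.IsNonGaussian r.curvature ∧ ∃ Δ > 0, T.HasMassGap Δ ∧ Literature.MathematicalPhysics.QuantumFieldTheory.HasLatticeMassGap r sch Δ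

-- item stmt-QuantumFields-9757 · support · rank 6 · open · by planner — informal only, no Lean statement yet:
--   [crux] REPELLER LEMMA — "asymptotic freedom forbids infrared freedom" (card
--   compactness-rigidity-ir-liouville K2; first foreseen child of IRLiouville in the split IRLiouville ⇐
--   LimitCompletion → RepellerLemma → NoAbelianOrInteractingLimit). For a compact simple G: there are a
--   Banach neighbourhood 𝒰 of the free (Gaussian) fixed point in a space of gauge-invariant unit-lattice
--   effective actions for G (small-field analytic part + large-field weights, Bałaban CMP 109/122 format
--   — the posited interface EffectiveActionChart, definition request D1), a marginal coordinate g : 𝒰 →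
--   ℝ≥0 vanishing exactly

/-- item stmt-QuantumFields-9708 · support · rank 9 · closed · proved by Summit.QuantumFields.YangMills.Theorems.StrongCouplingIRTrivial.strongCouplingIRTrivial_proof @ ab7f1dec5447 (prover) · by planner
sources: OsterwalderSeilerAnnPhys1978, Literature.Barriers.QuantumFields.FixedCouplingUltralocality, Literature.MathematicalPhysics.QuantumFieldTheory.osterwalder_seiler_torusClustering
[support] calibration where theorems exist: for every compact G and r there is β_s > 0 such that for
0 ≤ β < β_s every infrared limit point (same class as IRLiouville) has vanishing TWO-point functions
on off-diagonal tensors — from the proved torus cluster expansion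
(osterwalder_seiler_torusClustering_holds, needed uniformly in the displacement) and the proved
ultralocality estimate (FixedCouplingUltralocality_holds) plus Schwartz-tail and ⁰𝒮-flatness
bookkeeping; validates the typed IR-limit class. [difficulty: M] -/
@[route_item "route-QuantumFields-InfraredLiouville"]
def StrongCouplingIRTrivial : Prop :=
  open Literature.MathematicalPhysics.QuantumFieldTheory Literature.MathematicalPhysics.QuantumLattice Literature.MathematicalPhysics.AQFT in ∀ (G : Type) [Group G] [TopologicalSpace G] [IsTopologicalGroup G] [CompactSpace G] [MeasurableSpace G] [BorelSpace G] (r : LatticeRep G), ∃ βs : ℝ, 0 < βs ∧ ∀ β : ℝ, 0 ≤ β → β < βs → ∀ (sch : SpeciesScheme (YMSpecies G)) (S : LabelledSchwingerFamily (YMSpecies G) (EuclideanSpace ℝ (Fin 4))), (∀ k : ℕ, sch.β k = β) → (∀ s : YMSpecies G, ∃ (p : ℕ) (K : ℝ), ∀ k : ℕ, |sch.c s k| ≤ K * (sch.a k)⁻¹ ^ p) → (∀ (s : YMSpecies G) (k : ℕ), sch.m s k = ∫ U, s.F (torusLift (sch.side k) U) ∂(wilsonMeasure (d := 4) (L :=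 sch.side k) r.ρ (sch.β k))) → (∀ n : ℕ, n ≠ 0 → ∀ (σ : Fin n → YMSpecies G) (f : Fin n → SchwartzMap (EuclideanSpace ℝ (Fin 4)) ℝ) (F : SchwartzMap (Fin n → EuclideanSpace ℝ (Fin 4)) ℂ), IsTensorOf F (fun i => ofRealTest (f i)) → IsOffDiagonal F → Filter.Tendsto (fun k : ℕ => ((latticeSchwinger r.ρ sch (fun s => s.F) k n σ f : ℝ) : ℂ)) Filter.atTop (nhds (S n σ F))) → ∀ (σ : Fin 2 → YMSpecies G) (f : Fin 2 → SchwartzMap (EuclideanSpace ℝ (Fin 4)) ℝ) (F : SchwartzMap (Fin 2 → EuclideanSpace ℝ (Fin 4)) ℂ), IsTensorOf F (fun i => ofRealTest (f i)) → IsOffDiagonal F → S 2 σ F = 0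

-- `StrongCouplingIRTrivial` holds: proved by `Summit.QuantumFields.YangMills.Theorems.StrongCouplingIRTrivial.strongCouplingIRTrivial_proof` @ ab7f1dec5447 (its module imports this route file, so no `_holds` link can be stated here).

/-- item stmt-QuantumFields-9709 · assembly · rank 1 · closed · proved by Summit.QuantumFields.YangMills.Theorems.infraredLiouville_assembly_proof (prover) · by planner
sources: JaffeWitten2000, KenigMerle2006
[assembly] IRLiouville → IRCompactness → ThinEdgeExclusion → GapToContinuum → YangMills. -/
@[route_item "route-QuantumFields-InfraredLiouville"]
def Assembly : Prop :=
  IRLiouville → IRCompactness → ThinEdgeExclusion → GapToContinuum → YangMills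

-- `Assembly` holds: proved by `Summit.QuantumFields.YangMills.Theorems.infraredLiouville_assembly_proof` (its module imports this route file, so no `_holds` link can be stated here).

/-! D-0027 §2.1 — DECIDING THEOREM (planner-authored via `route open/edit --closes-file`; by planner-rrepair-QuantumFields-InfraredLiouvill-04472d9e-0 2026-08-16T17:35:34Z):
its hypotheses are this route's items and its conclusion the sub-problem Statement (glue_lint), and it elaborates with this file. -/

@[closes "route-QuantumFields-InfraredLiouville"] theorem closes : IRLiouville → IRCompactness → ThinEdgeExclusion → GapToContinuum → YangMills := by
  intro hL hC hT hG G _ _ _ _ hGs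
  letI : MeasurableSpace G := borel G
  haveI : BorelSpace G := ⟨rfl⟩
  obtain ⟨r⟩ := hGs.2
  obtain ⟨β₀, hβ₀⟩ := hL G hGs r
  refine ⟨r, hG G hGs r (hT G r β₀ fun β hβ A B => ?_)⟩
  by_contra hdec
  obtain ⟨sch, S, h1, h2, h3, h4, n, hn, σ, f, F, hF, hO, hne⟩ := hC G r β A B hdec
  exact hne (hβ₀ β hβ sch S h1 h2 h3 h4 n hn σ f F hF hO)

end Summit.QuantumFields.YangMills.Theses.InfraredLiouville
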